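import Mathlib
import HarnessLib
import Literature.MathematicalPhysics.StatisticalMechanics.RenormalisationMap
import Literature.MathematicalPhysics.StatisticalMechanics.RelevantHamiltonianStepOperator

/-!
# The fluctuation integral of a relevant Hamiltonian: `R_{k+1}H(B) = A_k H(B)` and
# `H_{k+1} = A_k H_k + B_k K_k` ([ABKM19] (6.56)–(6.57), proof of Theorem 6.8)

For a relevant Hamiltonian `H(B, φ) = Σ_{x∈B} [a_∅ + Σ_α a_α ∇^αφ(x) + Σ_{i≤j} a_{ij} ∇_iφ(x)∇_jφ(x)]`
and the centred Gaussian fluctuation measure `μ_{k+1} = N(0, circulant 𝒞)`,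
`∫ H(B, φ + ξ) μ_{k+1}(dξ) = H(B, φ) + |B| Σ_{i≤j} a_{ij} γ_{ij}` with the second moments of the
fluctuation gradient `γ_{ij} = E[∇_iξ(x)∇_jξ(x)] = 𝒞(e_i − e_j) − 𝒞(e_i) − 𝒞(−e_j) + 𝒞(0)` (linear terms
in `ξ` integrate to zero; [ABKM19] (6.62)–(6.64)).  In coefficients this is the operator `A_k` of
`RelevantHamiltonianStepOperator` (`stepOpA γ`): `R_{k+1}H(B) = (A_k H)(B)` as functionals.  Since
`Π₂` is the identity on relevant Hamiltonians (`Pi2_eval`), the `H`-component of the renormalisation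
transformation `T_k` (`RenormalisationMap.nextH`) is `H_{k+1} = A_k H_k + B_k K_k` with
`B_k K = −Π₂ R_{k+1} K(B₀)` ((6.57)) — EXACTLY, not only to first order.

* `gradCov 𝒞 q` — `γ_q`; moments of the step measure: `integrable_apply_stepMeasure`,
  `integrable_apply_mul_apply_stepMeasure`, `integral_apply_stepMeasure` (`E ξ(x) = 0`),
  `integral_apply_mul_apply_stepMeasure` (`E ξ(x)ξ(y) = 𝒞(x−y)`), `integral_linear_stepMeasure`,
  `integral_fwdDiff_mul_fwdDiff_stepMeasure` (`E ∇_iξ(x)∇_jξ(x) = γ_{ij}`);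
* `integral_relMonomial_add_stepMeasure` — `E[m_ι(φ + ξ)] = m_ι(φ) + (0, 0, γ_q)`;
* **`fluct_eval`** — `R_{k+1}(H(B,·))(φ) = (A_k H)(B, φ)`;
* `opB D K := −Π₂ R_{k+1} K(B₀)`, **`nextH_eq`** — `H_{k+1} = A_k H_k + B_k K_k` for the concrete
  `T_k`, under the no-wrapping hypothesis of `Pi2_eval` on the reference block.

Everything is proved; no named fact.

## References
* S. Adams, S. Buchholz, R. Kotecký, S. Müller, arXiv:1910.13564, Theorem 6.8 (6.56)–(6.57) and
  its proof (6.61)–(6.64) [AdamsBuchholzKoteckyMuller2019].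
-/

noncomputable section

namespace Literature.MathematicalPhysics.StatisticalMechanics.GradientRG

open scoped BigOperators Classical
open Finset MeasureTheory ProbabilityTheory
open Literature.MathematicalPhysics.StatisticalMechanics.GradientFRD (fwdDiff iterDiff)
open Literature.Barriers.CriticalPhenomena.LongRangePhi4 (fieldGaussian integral_eval_fieldGaussian
  integral_eval_mul_eval_fieldGaussian)

variable {d M : ℕ} [NeZero M]

/-! ## Moments of the step measure -/

/-- **The second moments of the fluctuation gradient**: `γ_{ij} = E[∇_iξ(x)∇_jξ(x)]
= 𝒞(e_i − e_j) − 𝒞(e_i) − 𝒞(−e_j) + 𝒞(0)` (independent of `x`).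
[cite: AdamsBuchholzKoteckyMuller2019, Theorem 6.8 (6.63)] -/
def gradCov (𝒞 : (Fin d → ZMod M) → ℝ) (q : quadIndex d) : ℝ :=
  𝒞 (Pi.single q.1.1 1 - Pi.single q.1.2 1) - 𝒞 (Pi.single q.1.1 1) - 𝒞 (-Pi.single q.1.2 1) + 𝒞 0

/-- The shift of the Taylor data under `R_{k+1}`: `0` for the constant and linear monomials,
`γ_q` for the quadratic ones. [cite: AdamsBuchholzKoteckyMuller2019, Theorem 6.8 (6.64)] -/
def monoShift (γ : quadIndex d → ℝ) (ι : RelIndex d) : ℝ :=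
  match ι with
  | Sum.inl _ => 0
  | Sum.inr (Sum.inl _) => 0
  | Sum.inr (Sum.inr q) => γ q

section Moments

variable {𝒞 : (Fin d → ZMod M) → ℝ} (hC : (Matrix.circulant 𝒞).PosSemidef)
include hC

omit hC in
/-- Coordinates are square integrable under the multivariate Gaussian.
[cite: AdamsBuchholzKoteckyMuller2019, Ch. 6.1] -/
private theorem memLp_coord (z : Fin d → ZMod M) :
    MemLp (fun ψ : EuclideanSpace ℝ (Fin d → ZMod M) => ψ z) 2
      (multivariateGaussian (0 : EuclideanSpace ℝ (Fin d → ZMod M)) (Matrix.circulant 𝒞)) := by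
  have h := IsGaussian.memLp_dual (multivariateGaussian (0 : EuclideanSpace ℝ (Fin d → ZMod M))
    (Matrix.circulant 𝒞)) (EuclideanSpace.proj (𝕜 := ℝ) z) 2 (by simp)
  simpa [EuclideanSpace.coe_proj] using h

omit hC in
/-- `ξ(x)` is integrable under the step measure. [cite: AdamsBuchholzKoteckyMuller2019, Ch. 6.1] -/
theorem integrable_apply_stepMeasure (x : Fin d → ZMod M) :
    Integrable (fun ξ : (Fin d → ZMod M) → ℝ => ξ x) (stepMeasure 𝒞) := by
  have hmx : Measurable (fun ξ : (Fin d → ZMod M) → ℝ => ξ x) := measurable_pi_apply x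
  unfold stepMeasure
  rw [integrable_map_measure hmx.aestronglyMeasurable (PiLp.continuous_ofLp 2 _).measurable.aemeasurable]
  exact (memLp_coord x).integrable one_le_two

omit hC in
/-- `ξ(x)ξ(y)` is integrable under the step measure. [cite: AdamsBuchholzKoteckyMuller2019, Ch. 6.1] -/
theorem integrable_apply_mul_apply_stepMeasure (x y : Fin d → ZMod M) :
    Integrable (fun ξ : (Fin d → ZMod M) → ℝ => ξ x * ξ y) (stepMeasure 𝒞) := by
  have hmx : Measurable (fun ξ : (Fin d → ZMod M) → ℝ => ξ x) := measurable_pi_apply x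
  have hmy : Measurable (fun ξ : (Fin d → ZMod M) → ℝ => ξ y) := measurable_pi_apply y
  have hm : Measurable (fun ξ : (Fin d → ZMod M) → ℝ => ξ x * ξ y) := hmx.mul hmy
  unfold stepMeasure
  rw [integrable_map_measure hm.aestronglyMeasurable (PiLp.continuous_ofLp 2 _).measurable.aemeasurable]
  exact (memLp_coord x).integrable_mul (memLp_coord y)

/-- **`E ξ(x) = 0`.** [cite: AdamsBuchholzKoteckyMuller2019, Theorem 6.8 (proof: "linear terms vanish")] -/
theorem integral_apply_stepMeasure (x : Fin d → ZMod M) :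
    ∫ ξ, (fun ξ : (Fin d → ZMod M) → ℝ => ξ x) ξ ∂(stepMeasure 𝒞) = 0 := by
  have hmx : Measurable (fun ξ : (Fin d → ZMod M) → ℝ => ξ x) := measurable_pi_apply x
  rw [integral_stepMeasure_eq_fieldGaussian hC hmx.aestronglyMeasurable]
  exact integral_eval_fieldGaussian _ x 0

/-- **`E ξ(x)ξ(y) = 𝒞(x − y)`.** [cite: AdamsBuchholzKoteckyMuller2019, Theorem 6.8 (6.63)] -/
theorem integral_apply_mul_apply_stepMeasure (x y : Fin d → ZMod M) :
    ∫ ξ, (fun ξ : (Fin d → ZMod M) → ℝ => ξ x * ξ y) ξ ∂(stepMeasure 𝒞) = 𝒞 (x - y) := by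
  have hmx : Measurable (fun ξ : (Fin d → ZMod M) → ℝ => ξ x) := measurable_pi_apply x
  have hmy : Measurable (fun ξ : (Fin d → ZMod M) → ℝ => ξ y) := measurable_pi_apply y
  have hm : Measurable (fun ξ : (Fin d → ZMod M) → ℝ => ξ x * ξ y) := hmx.mul hmy
  rw [integral_stepMeasure_eq_fieldGaussian hC (F := fun ξ => ξ x * ξ y) hm.aestronglyMeasurable]
  show ∫ φ, φ x 0 * φ y 0 ∂(fieldGaussian (Fin d → ZMod M) (Matrix.circulant 𝒞) 1) = 𝒞 (x - y)
  rw [integral_eval_mul_eval_fieldGaussian hC]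
  simp [Matrix.circulant_apply]

/-- A linear functional of the field has mean zero (and is integrable) under the step measure.
[cite: AdamsBuchholzKoteckyMuller2019, Theorem 6.8 (proof: "linear terms vanish")] -/
theorem integral_linear_stepMeasure (Z : ((Fin d → ZMod M) → ℝ) →ₗ[ℝ] ℝ) :
    Integrable (fun ξ => Z ξ) (stepMeasure 𝒞) ∧ ∫ ξ, Z ξ ∂(stepMeasure 𝒞) = 0 := by
  set c : (Fin d → ZMod M) → ℝ := fun y => Z (fun j => if y = j then 1 else 0) with hc
  have hZ : ∀ ξ : (Fin d → ZMod M) → ℝ, Z ξ = ∑ y, ξ y * c y := by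
    intro ξ
    rw [LinearMap.pi_apply_eq_sum_univ Z ξ]
    rfl
  simp_rw [hZ]
  refine ⟨integrable_finsetSum _ fun y _ => (integrable_apply_stepMeasure y).mul_const _, ?_⟩
  rw [integral_finsetSum _ fun y _ => (integrable_apply_stepMeasure y).mul_const _]
  refine Finset.sum_eq_zero fun y _ => ?_
  rw [integral_mul_const, integral_apply_stepMeasure hC y, zero_mul]

/-- `ξ ↦ ∇^αξ(x)` as a linear functional. [cite: AdamsBuchholzKoteckyMuller2019, Ch. 6.4] -/
def iterDiffLM (α : Fin d → ℕ) (x : Fin d → ZMod M) : ((Fin d → ZMod M) → ℝ) →ₗ[ℝ] ℝ where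
  toFun ξ := iterDiff α ξ x
  map_add' ξ η := by rw [iterDiff_add]; rfl
  map_smul' c ξ := by rw [iterDiff_smul]; rfl

/-- **`∇^αξ(x)` is integrable with mean zero.** [cite: AdamsBuchholzKoteckyMuller2019, Theorem 6.8 (proof)] -/
theorem integral_iterDiff_stepMeasure (α : Fin d → ℕ) (x : Fin d → ZMod M) :
    Integrable (fun ξ : (Fin d → ZMod M) → ℝ => iterDiff α ξ x) (stepMeasure 𝒞) ∧
      ∫ ξ, iterDiff α ξ x ∂(stepMeasure 𝒞) = 0 :=
  integral_linear_stepMeasure hC (iterDiffLM α x)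

/-- **`∇_iξ(x)` is integrable with mean zero.** [cite: AdamsBuchholzKoteckyMuller2019, Theorem 6.8 (proof)] -/
theorem integral_fwdDiff_stepMeasure (i : Fin d) (x : Fin d → ZMod M) :
    Integrable (fun ξ : (Fin d → ZMod M) → ℝ => fwdDiff i ξ x) (stepMeasure 𝒞) ∧
      ∫ ξ, fwdDiff i ξ x ∂(stepMeasure 𝒞) = 0 := by
  have h := integral_iterDiff_stepMeasure hC (Pi.single i 1) x
  simp_rw [iterDiff_single] at h
  exact h

/-- **`∇_iξ(x)∇_jξ(x)` is integrable with mean `γ_{ij}`.** [cite: AdamsBuchholzKoteckyMuller2019, Theorem 6.8 (6.63)] -/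
theorem integral_fwdDiff_mul_fwdDiff_stepMeasure (q : quadIndex d) (x : Fin d → ZMod M) :
    Integrable (fun ξ : (Fin d → ZMod M) → ℝ => fwdDiff q.1.1 ξ x * fwdDiff q.1.2 ξ x) (stepMeasure 𝒞) ∧
      ∫ ξ, fwdDiff q.1.1 ξ x * fwdDiff q.1.2 ξ x ∂(stepMeasure 𝒞) = gradCov 𝒞 q := by
  have hexp : ∀ ξ : (Fin d → ZMod M) → ℝ, fwdDiff q.1.1 ξ x * fwdDiff q.1.2 ξ x =
      ξ (x + Pi.single q.1.1 1) * ξ (x + Pi.single q.1.2 1) - ξ (x + Pi.single q.1.1 1) * ξ x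
        - ξ x * ξ (x + Pi.single q.1.2 1) + ξ x * ξ x := by
    intro ξ; simp only [GradientFRD.fwdDiff]; ring
  simp_rw [hexp]
  have I : ∀ a b : Fin d → ZMod M, Integrable (fun ξ : (Fin d → ZMod M) → ℝ => ξ a * ξ b) (stepMeasure 𝒞) :=
    fun a b => integrable_apply_mul_apply_stepMeasure a b
  have I2 : Integrable (fun ξ : (Fin d → ZMod M) → ℝ =>
      ξ (x + Pi.single q.1.1 1) * ξ (x + Pi.single q.1.2 1) - ξ (x + Pi.single q.1.1 1) * ξ x) (stepMeasure 𝒞) :=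
    (I _ _).sub (I _ _)
  have I3 : Integrable (fun ξ : (Fin d → ZMod M) → ℝ =>
      ξ (x + Pi.single q.1.1 1) * ξ (x + Pi.single q.1.2 1) - ξ (x + Pi.single q.1.1 1) * ξ x
        - ξ x * ξ (x + Pi.single q.1.2 1)) (stepMeasure 𝒞) := I2.sub (I _ _)
  refine ⟨I3.add (I _ _), ?_⟩
  rw [integral_add I3 (I _ _), integral_sub I2 (I _ _), integral_sub (I _ _) (I _ _)]
  have e0 : ∀ a b : Fin d → ZMod M, ∫ ξ : (Fin d → ZMod M) → ℝ, ξ a * ξ b ∂(stepMeasure 𝒞) = 𝒞 (a - b) :=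
    fun a b => integral_apply_mul_apply_stepMeasure hC a b
  rw [e0, e0, e0, e0, gradCov]
  have e1 : x + Pi.single q.1.1 1 - (x + Pi.single q.1.2 1) = (Pi.single q.1.1 1 - Pi.single q.1.2 1 : Fin d → ZMod M) := by abel
  have e2 : x + Pi.single q.1.1 1 - x = (Pi.single q.1.1 1 : Fin d → ZMod M) := by abel
  have e3 : x - (x + Pi.single q.1.2 1) = (-Pi.single q.1.2 1 : Fin d → ZMod M) := by abel
  rw [e1, e2, e3, sub_self]

/-- **`E[m_ι(φ + ξ)] = m_ι(φ) + (0, 0, γ)_ι`** for the three kinds of relevant monomials, with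
integrability. [cite: AdamsBuchholzKoteckyMuller2019, Theorem 6.8 (6.62)–(6.64)] -/
theorem integral_relMonomial_add_stepMeasure (ι : RelIndex d) (φ : (Fin d → ZMod M) → ℝ)
    (x : Fin d → ZMod M) :
    Integrable (fun ξ : (Fin d → ZMod M) → ℝ => relMonomial ι (φ + ξ) x) (stepMeasure 𝒞) ∧
      ∫ ξ, relMonomial ι (φ + ξ) x ∂(stepMeasure 𝒞) = relMonomial ι φ x + monoShift (gradCov 𝒞) ι := by
  haveI := isProbabilityMeasure_stepMeasure 𝒞
  rcases ι with u | α | q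
  · simp only [relMonomial_const, monoShift, add_zero]
    exact ⟨integrable_const _, by simp⟩
  · simp only [relMonomial_lin, monoShift, add_zero]
    simp_rw [iterDiff_add, Pi.add_apply]
    obtain ⟨hI, h0⟩ := integral_iterDiff_stepMeasure hC α.1 x
    refine ⟨(integrable_const _).add hI, ?_⟩
    rw [integral_add (integrable_const _) hI, h0, add_zero]
    simp
  · simp only [relMonomial_quad, monoShift]
    have hexp : ∀ ξ : (Fin d → ZMod M) → ℝ, fwdDiff q.1.1 (φ + ξ) x * fwdDiff q.1.2 (φ + ξ) x =
        fwdDiff q.1.1 φ x * fwdDiff q.1.2 φ x + fwdDiff q.1.1 φ x * fwdDiff q.1.2 ξ x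
          + fwdDiff q.1.2 φ x * fwdDiff q.1.1 ξ x + fwdDiff q.1.1 ξ x * fwdDiff q.1.2 ξ x := by
      intro ξ; rw [fwdDiff_add, fwdDiff_add]; simp only [Pi.add_apply]; ring
    simp_rw [hexp]
    obtain ⟨hI1, h01⟩ := integral_fwdDiff_stepMeasure hC q.1.1 x
    obtain ⟨hI2, h02⟩ := integral_fwdDiff_stepMeasure hC q.1.2 x
    obtain ⟨hIq, h0q⟩ := integral_fwdDiff_mul_fwdDiff_stepMeasure hC q x
    have hA : Integrable (fun ξ : (Fin d → ZMod M) → ℝ =>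
        fwdDiff q.1.1 φ x * fwdDiff q.1.2 φ x + fwdDiff q.1.1 φ x * fwdDiff q.1.2 ξ x) (stepMeasure 𝒞) :=
      (integrable_const _).add (hI2.const_mul _)
    have hB : Integrable (fun ξ : (Fin d → ZMod M) → ℝ =>
        fwdDiff q.1.1 φ x * fwdDiff q.1.2 φ x + fwdDiff q.1.1 φ x * fwdDiff q.1.2 ξ x
          + fwdDiff q.1.2 φ x * fwdDiff q.1.1 ξ x) (stepMeasure 𝒞) := hA.add (hI1.const_mul _)
    refine ⟨hB.add hIq, ?_⟩
    have i0 : ∫ ξ : (Fin d → ZMod M) → ℝ, fwdDiff q.1.1 φ x * fwdDiff q.1.2 φ x ∂(stepMeasure 𝒞) =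
        fwdDiff q.1.1 φ x * fwdDiff q.1.2 φ x := by
      rw [integral_const, probReal_univ, one_smul]
    have i1 : ∫ ξ : (Fin d → ZMod M) → ℝ, fwdDiff q.1.1 φ x * fwdDiff q.1.2 ξ x ∂(stepMeasure 𝒞) = 0 := by
      rw [integral_const_mul, h02, mul_zero]
    have i2 : ∫ ξ : (Fin d → ZMod M) → ℝ, fwdDiff q.1.2 φ x * fwdDiff q.1.1 ξ x ∂(stepMeasure 𝒞) = 0 := by
      rw [integral_const_mul, h01, mul_zero]
    rw [integral_add hB hIq, integral_add hA (hI1.const_mul _),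
      integral_add (integrable_const _) (hI2.const_mul _), i0, i1, i2, h0q]
    ring

end Moments

/-! ## `R_{k+1} H(B) = A_k H(B)` -/

omit [NeZero M] in
/-- The density of `A_k H` is the density of `H` plus the constant `Σ_q γ_q a_q`.
[cite: AdamsBuchholzKoteckyMuller2019, Lemma 10.5 (10.37)] -/
theorem density_stepOpA {𝕜 : Type*} [NormedField 𝕜] [NormedAlgebra ℝ 𝕜] (γ : quadIndex d → ℝ)
    (H : RelevantHamiltonian 𝕜 d) (φ : (Fin d → ZMod M) → ℝ) (x : Fin d → ZMod M) :
    density (stepOpA γ H) φ x = ∑ ι : RelIndex d, (relMonomial ι φ x + monoShift γ ι) • H ι := by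
  unfold density
  rw [Fintype.sum_sum_type, Fintype.sum_sum_type, Fintype.sum_sum_type, Fintype.sum_sum_type]
  simp only [relMonomial_const, one_smul, stepOpA_const, relMonomial_lin, stepOpA_lin, relMonomial_quad,
    stepOpA_quad, monoShift, add_zero, Fintype.sum_unique, add_smul, Finset.sum_add_distrib]
  abel

/-- **`R_{k+1}H(B) = A_k H(B)`**: `∫ H(B, φ + ξ) μ_{k+1}(dξ) = (A_k H)(B, φ)` with
`γ = gradCov 𝒞` — the linear terms in `ξ` vanish and the quadratic ones contribute `|B| Σ_q a_q γ_q`.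
[cite: AdamsBuchholzKoteckyMuller2019, Theorem 6.8 (6.61)–(6.64)] -/
theorem fluct_eval {𝒞 : (Fin d → ZMod M) → ℝ} (hC : (Matrix.circulant 𝒞).PosSemidef)
    (H : RelevantHamiltonian ℂ d) (B : Finset (Fin d → ZMod M)) (φ : (Fin d → ZMod M) → ℝ) :
    fluct 𝒞 (eval H B) φ = eval (stepOpA (gradCov 𝒞) H) B φ := by
  unfold fluct eval
  have hsite : ∀ x : Fin d → ZMod M,
      Integrable (fun ξ => density H (φ + ξ) x) (stepMeasure 𝒞) ∧
      ∫ ξ, density H (φ + ξ) x ∂(stepMeasure 𝒞) = density (stepOpA (gradCov 𝒞) H) φ x := by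
    intro x
    have hterm : ∀ ι : RelIndex d,
        Integrable (fun ξ => (relMonomial ι (φ + ξ) x) • H ι) (stepMeasure 𝒞) :=
      fun ι => (integral_relMonomial_add_stepMeasure hC ι φ x).1.smul_const _
    rw [density_stepOpA]
    unfold density
    refine ⟨integrable_finsetSum _ fun ι _ => hterm ι, ?_⟩
    rw [integral_finsetSum _ fun ι _ => hterm ι]
    refine Finset.sum_congr rfl fun ι _ => ?_
    rw [integral_smul_const, (integral_relMonomial_add_stepMeasure hC ι φ x).2]
  rw [integral_finsetSum _ fun x _ => (hsite x).1]
  exact Finset.sum_congr rfl fun x _ => (hsite x).2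

/-! ## `H_{k+1} = A_k H_k + B_k K_k` -/

/-- **The operator `B_k`** ((6.57)): `B_k K = −Π₂ R_{k+1} K(B₀)` (read off at the reference block).
[cite: AdamsBuchholzKoteckyMuller2019, Theorem 6.8 (6.57)] -/
def opB (D : StepData d M) (K : Finset (Fin d → ZMod M) → ((Fin d → ZMod M) → ℝ) → ℂ) :
    RelevantHamiltonian ℂ d :=
  -Pi2 D.c₀ D.B₀ (fluct D.𝒞 (K D.B₀))

/-- **`H_{k+1} = A_k H_k + B_k K_k`** for the concrete `T_k` (`RenormalisationMap.nextH`), exactly: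
`Π₂ R_{k+1} H(B₀) = A_k H` by `fluct_eval` and `Pi2_eval` (reference block non-empty, with room
for the test polynomials: `HasRoom c₀ x (⌊d/2⌋+1)` for `x ∈ B₀`).
[cite: AdamsBuchholzKoteckyMuller2019, Theorem 6.8 (6.55)–(6.57)] -/
theorem nextH_eq (D : StepData d M) (hC : (Matrix.circulant D.𝒞).PosSemidef) (hB : D.B₀.card ≠ 0)
    (hroom : ∀ x ∈ D.B₀, HasRoom D.c₀ x (d / 2 + 1)) (H : RelevantHamiltonian ℂ d)
    (K : Finset (Fin d → ZMod M) → ((Fin d → ZMod M) → ℝ) → ℂ) :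
    nextH D H K = stepOpA (gradCov D.𝒞) H + opB D K := by
  unfold nextH opB
  have h1 : fluct D.𝒞 (eval H D.B₀) = fun φ => eval (stepOpA (gradCov D.𝒞) H) D.B₀ φ :=
    funext fun φ => fluct_eval hC H D.B₀ φ
  rw [h1, Pi2_eval hB hroom, sub_eq_add_neg]

end Literature.MathematicalPhysics.StatisticalMechanics.GradientRG

end
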